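import Literature.AlgebraicGeometry.HodgeTheory.FermatCubicSurfaceLineClasses
import Literature.AlgebraicGeometry.HodgeTheory.ComplexGysinRational
import Literature.AlgebraicGeometry.HodgeTheory.ComplexGysinHodgeType
import Literature.AlgebraicGeometry.HodgeTheory.RationalClassesRingChange
import Literature.AlgebraicGeometry.HodgeTheory.HodgeFiltrationModelsReductionProofs
import Literature.AlgebraicGeometry.HodgeTheory.GysinFormalismHodgeOfGysin
import Literature.AlgebraicGeometry.HodgeTheory.HodgeTypeConjugation
import Literature.AlgebraicGeometry.HodgeTheory.ComplexConjugationHolds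
import Literature.AlgebraicGeometry.Motives.ComplexPointsOrientation
import Literature.NumberTheory.Transcendental.DeRhamTheoremMultiplicative
import Literature.AlgebraicTopology.SingularHomology.CohomologyRingChange
import HarnessLib

/-!
# Seven independent rational `(1,1)`-classes on the Fermat cubic surface (`ρ(X²₃) ≥ 7`)

Family `hodge`, layer `Literature/AlgebraicGeometry/HodgeTheory`. On the Fermat cubic surface
`X = X²₃ ⊂ ℙ³_ℂ` the `27` lines span the Néron–Severi group, of rank `ρ = 7` (Hartshorne V
Prop. 4.8, Thm. 4.9, Ex. 4.16; Shioda–Aoki–Shioda: `NS(X²ₘ) ⊗ ℂ = ⨁_{α ∈ 𝔅} V(α) ⊕ V(0)`,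
`ρ(X²₃) = 7`). This PROOF FILE (theorems and three small definitions, no named facts) extracts
the lower bound that the refutation of `FermatHodgeClassesLiftToCurvePowers` needs, on the tree's
real carriers:

* `sevenLines`, `sevenProbes` — seven lines `ℓᵢ` and seven "probe" lines `ℓ'ᵢ` of `X²₃` in a
  LOWER-TRIANGULAR position: `ℓ'ᵢ` meets `ℓᵢ` (both in one system, second slopes equal, first
  slopes different) and is SKEW to `ℓ_k` for `k < i` (a configuration found by exhaustive search
  and certified by `decide` on the combinatorial meeting rule `CubicSurface.fermatMeet` of
  `CubicSurfaces/FermatCubicLines`, `interNum_fermatLine`);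
* `linearIndependent_of_lowerTriangular` — vectors `vᵢ` with linear functionals `fᵢ`,
  `fᵢ(v_k) = 0` (`k < i`), `fᵢ(vᵢ) ≠ 0`, are linearly independent;
* `linearIndependent_sevenLineClasses` — **the classes `cl(ℓᵢ) ∈ H²(X²₃(ℂ); ℂ)` of the seven
  lines are linearly independent** (`fᵢ = g_{ℓ'ᵢ}^*`: `FermatCubicSurfaceLineClasses`,
  `map_lineEmb_lineClass_eq_zero` / `…_ne_zero`);
* `exists_smul_lineClass_isRationalClass`, `isOfHodgeType_lineClass` — each `cl(ℓ)` is a non-zero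
  complex multiple of a RATIONAL class (the Gysin morphism on rational classes is the rational
  Gysin homomorphism up to the orientation scalar, `complexGysin_ringChange_eq_smul_gysinMap`) and
  is of Hodge type `(1,1)` (`isOfHodgeType_complexGysin`, Voisin I §7.3.2 / §11.1.2);
* `seven_le_finrank_span_rational_one_one` — **`7 ≤ dim_ℂ span{rational (1,1)-classes of
  H²(X²₃(ℂ); ℂ)}`**, the hypothesis `h₇` of `not_fermatHodgeClassesLiftToCurvePowers_of_finrank`
  (`FermatHodgeClassesLiftToCurveAndJacobianPowers`). In print `= 7 = ρ(X²₃) = h^{1,1}(X²₃)`.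

## References

* [Hartshorne1977] R. Hartshorne, Algebraic Geometry (1977), V Prop. 4.8, Thm. 4.9, Ex. 4.16.
* [AokiShioda1983] N. Aoki, T. Shioda, Generators of the Néron–Severi group of a Fermat surface,
  Progr. Math. 35 (1983), §2 (2.3): `ρ(X²ₘ) = |𝔅²ₘ| + 1`.
* [VoisinHodgeI2002] C. Voisin, Hodge Theory I, §7.1.1, §7.3.2, §11.1.2, §11.3.
* [FultonYoungTableaux1997] W. Fulton, Young Tableaux, App. B §B.1 (5).
-/

noncomputable section

open CategoryTheory AlgebraicGeometry
open Literature.AlgebraicGeometry.Motives Literature.AlgebraicTopology.SingularHomology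
open Literature.NumberTheory.Transcendental
open Literature.AlgebraicGeometry.CubicSurfaces Literature.AlgebraicGeometry.CubicSurfaces.CubicSurface

namespace Literature.AlgebraicGeometry.HodgeTheory

/-! ### Linear independence from a lower-triangular system of functionals -/

/-- **Triangular independence**: if linear maps `fᵢ` satisfy `fᵢ(v_k) = 0` for `k < i` and
`fᵢ(vᵢ) ≠ 0`, the vectors `vᵢ` are linearly independent (apply `fᵢ` for the largest index `i`
with a non-zero coefficient). [folklore] -/
theorem linearIndependent_of_lowerTriangular {K V W : Type*} [Field K] [AddCommGroup V] [Module K V]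
    [AddCommGroup W] [Module K W] {n : ℕ} (v : Fin n → V) (f : Fin n → V →ₗ[K] W)
    (h0 : ∀ i k, k < i → f i (v k) = 0) (h1 : ∀ i, f i (v i) ≠ 0) : LinearIndependent K v := by
  classical
  rw [Fintype.linearIndependent_iff]
  intro g hg
  by_contra hne
  obtain ⟨i₀, hi₀⟩ := not_forall.mp hne
  set S : Finset (Fin n) := Finset.univ.filter fun i ↦ g i ≠ 0 with hS
  have hSne : S.Nonempty := ⟨i₀, by simp [hS, hi₀]⟩
  set i := S.max' hSne with hi
  have hgi : g i ≠ 0 := (Finset.mem_filter.mp (S.max'_mem hSne)).2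
  have hgt : ∀ j, i < j → g j = 0 := fun j hj ↦ by
    by_contra h
    exact absurd (S.le_max' j (by simp [hS, h])) (not_le.mpr hj)
  have key := congrArg (f i) hg
  rw [map_sum, map_zero, Finset.sum_eq_single i] at key
  · rw [map_smul] at key
    exact hgi ((smul_eq_zero.mp key).resolve_right (h1 i))
  · intro k _ hki
    rcases lt_or_gt_of_ne hki with hlt | hlt
    · rw [map_smul, h0 i k hlt, smul_zero]
    · rw [hgt k hlt, zero_smul, map_zero]
  · intro h
    exact absurd (Finset.mem_univ i) h

/-! ### The configuration of seven lines and seven probes -/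

/-- **Seven lines `ℓ₀, …, ℓ₆` of the Fermat cubic surface** (system, first and second exponent of
the slopes `-ωᵃ, -ωᵇ`): `A(0,0), A(0,1), A(1,2), B(0,0), C(1,0), B(1,1), C(1,1)` with
`A = (01|23)`, `B = (02|13)`, `C = (03|12)`. [cite: Hartshorne1977, V Ex. 4.16] -/
def sevenLines : Fin 7 → FermatIdx :=
  ![(.s0, 0, 0), (.s0, 0, 1), (.s0, 1, 2), (.s1, 0, 0), (.s2, 1, 0), (.s1, 1, 1), (.s2, 1, 1)]

/-- The first exponents `a'ᵢ ≠ aᵢ` of the probes `ℓ'ᵢ = (pᵢ, a'ᵢ, bᵢ)`. [folklore] -/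
def sevenProbeExp : Fin 7 → ZMod 3 :=
  ![1, 1, 2, 1, 2, 2, 0]

/-- **The probes `ℓ'ᵢ = (pᵢ, a'ᵢ, bᵢ)`**: same system and second slope as `ℓᵢ`, different first
slope — so `ℓ'ᵢ` meets `ℓᵢ` — and skew to `ℓ_k` for all `k < i`. [cite: Hartshorne1977, V Ex. 4.16] -/
def sevenProbes (i : Fin 7) : FermatIdx :=
  ((sevenLines i).1, sevenProbeExp i, (sevenLines i).2.2)

/-- The probes change the first slope. [folklore] -/
theorem sevenProbeExp_ne (i : Fin 7) : sevenProbeExp i ≠ (sevenLines i).2.1 := by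
  revert i
  decide

/-- **The configuration is lower-triangular**: `ℓ_k` and `ℓ'ᵢ` are skew for `k < i` (the
combinatorial meeting rule `fermatMeet` vanishes; certified by `decide`). [cite: Hartshorne1977, V Ex. 4.16] -/
theorem fermatMeet_sevenLines_sevenProbes (i k : Fin 7) (hki : k < i) :
    fermatMeet (sevenLines k) (sevenProbes i) = 0 := by
  revert i k
  decide

/-- **Skewness from the meeting rule**: `fermatMeet u v = 0` means the planes of `u` and `v` meet
trivially (`interNum_fermatLine`: the intersection numbers of the `27` lines follow the rule, and
`interNum = 0` is skewness by definition). [cite: Hartshorne1977, V Ex. 4.16] -/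
theorem fermatPlane_inf_eq_bot_of_fermatMeet_eq_zero {u v : FermatIdx} (h : fermatMeet u v = 0) :
    fermatPlane ℂ u.1 (croot ω₃ u.2.1) (croot ω₃ u.2.2) ⊓ fermatPlane ℂ v.1 (croot ω₃ v.2.1) (croot ω₃ v.2.2) = ⊥ := by
  have key := interNum_fermatLine (k := ℂ) ℂ isPrimitiveRoot_ω₃ u v
  rw [h] at key
  unfold interNum at key
  by_contra hne
  have hne' : ((fermatLine ℂ ℂ isPrimitiveRoot_ω₃ u).1 ⊓ (fermatLine ℂ ℂ isPrimitiveRoot_ω₃ v).1 :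
      Submodule ℂ (Fin 4 → ℂ)) ≠ ⊥ := by
    simpa [coe_fermatLine] using hne
  by_cases h1 : fermatLine ℂ ℂ isPrimitiveRoot_ω₃ u = fermatLine ℂ ℂ isPrimitiveRoot_ω₃ v
  · rw [if_pos h1] at key
    norm_num at key
  · rw [if_neg h1, if_pos hne'] at key
    norm_num at key

/-! ### The seven classes are linearly independent -/

/-- Local notation: the Fermat cubic surface `X²₃ = V₊(Σ xᵢ³) ⊂ ℙ³`. -/
local notation "X₃" => fermatHypersurface (2 * 1) 3

variable (μ : OrientationFamily)

/-- **The classes of the seven lines are linearly independent in `H²(X²₃(ℂ); ℂ)`**, and so is any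
rescaling by non-zero scalars: the functionals `g_{ℓ'ᵢ}^*` are lower-triangular on them
(`map_lineEmb_lineClass_eq_zero` for the skew pairs, `map_lineEmb_lineClass_ne_zero` on the
diagonal). [cite: Hartshorne1977, V Ex. 4.16 and Thm. 4.9] -/
theorem linearIndependent_smul_sevenLineClasses (u : Fin 7 → ℂ) (hu : ∀ i, u i ≠ 0) :
    LinearIndependent ℂ fun i ↦ u i • lineClass μ (sevenLines i).1 (sevenLines i).2.1 (sevenLines i).2.2 := by
  refine linearIndependent_of_lowerTriangular _
    (fun i ↦ (complexBetti.map (lineEmb (sevenProbes i).1 (sevenProbes i).2.1 (sevenProbes i).2.2) (2 * 1)).hom)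
    (fun i k hki ↦ ?_) (fun i ↦ ?_)
  · rw [map_smul]
    change u k • complexBetti.map _ (2 * 1) _ = 0
    rw [map_lineEmb_lineClass_eq_zero μ
      (fermatPlane_inf_eq_bot_of_fermatMeet_eq_zero (fermatMeet_sevenLines_sevenProbes i k hki)), smul_zero]
  · rw [map_smul]
    change u i • complexBetti.map (lineEmb (sevenLines i).1 (sevenProbeExp i) (sevenLines i).2.2) (2 * 1) _ ≠ 0
    exact smul_ne_zero (hu i) (map_lineEmb_lineClass_ne_zero μ _ _ _ _ (sevenProbeExp_ne i))

/-! ### The line classes are (multiples of) rational classes of type `(1,1)` -/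

/-- Change of coefficients preserves the unit: `ι(1_ℚ) = 1_ℂ` (local copy of the tree's
`CharacteristicClasses.ringChange_one`, to keep the import closure small). [cite: HatcherAT2002, §3.2 p. 215] -/
private theorem ringChange_one_rat (Y : Type) [TopologicalSpace Y] :
    singularCohomology.ringChange (algebraMap ℚ ℂ) Y 0 (singularCohomology.one ℚ Y) =
      singularCohomology.one ℂ Y := by
  rw [singularCohomology.one, singularCohomology.one, singularCohomology.ringChange_π]
  congr 1
  refine coFn_injective ?_
  rw [coFn_cocyclesRingChange, coFn_cocyclesMk, coFn_cocyclesMk]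
  funext σ
  exact map_one (algebraMap ℚ ℂ)

/-- **`cl(ℓ)` is a non-zero complex multiple of a rational class**: `cl(ℓ) = g_* 1 = g_* ι(1_ℚ)
= u • ι(g_*^ℚ 1_ℚ)` with `u ≠ 0`, the Gysin morphism on rational classes being the rational Gysin
homomorphism up to the orientation scalar (`complexGysin_ringChange_eq_smul_gysinMap`; Voisin I
§7.3.2: `φ_*` is induced from `H_*(–; ℤ)` through Poincaré duality).
[cite: VoisinHodgeI2002, §7.3.2 and §11.1.2] [cite: FultonYoungTableaux1997, Appendix B §B.1 (5)] -/
theorem exists_smul_lineClass_isRationalClass (p : Sys) (a b : ZMod 3) :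
    ∃ u : ℂ, u ≠ 0 ∧ IsRationalClass (u • lineClass μ p a b) := by
  obtain ⟨νY⟩ := Motives.ComplexPoints.isOrientableOver ℚ isSmoothProjective_P1
  obtain ⟨νX⟩ := Motives.ComplexPoints.isOrientableOver ℚ isSmoothProjective_X₃
  have hνX : νX.HasPoincareDuality := fun p q h ↦
    Motives.ComplexPoints.bijective_poincareDualityMap_of_isSmoothProjective isSmoothProjective_X₃
      (by norm_num) νX h
  obtain ⟨u, hu, hgys⟩ := complexGysin_ringChange_eq_smul_gysinMap (μ := μ) μ.hasPoincareDuality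
    isSmoothProjective_P1 isSmoothProjective_X₃ (lineEmb p a b) (a := 0) (b := 2 * 1) (q := 2 * 1)
    (by norm_num) (by norm_num) νY νX hνX
  refine ⟨u⁻¹, inv_ne_zero hu, ?_⟩
  rw [lineClass_eq, ← ringChange_one_rat, hgys, smul_smul, inv_mul_cancel₀ hu, one_smul]
  exact isRationalClass_ringChange _

/-- **`cl(ℓ)` is of Hodge type `(1,1)`**: Gysin morphisms shift the Hodge type by the codimension
(`isOfHodgeType_complexGysin`, fed with the tree's discharged Hodge decomposition facts), and
`1 ∈ H⁰(ℙ¹(ℂ))` is of type `(0,0)`. [cite: VoisinHodgeI2002, §7.3.2 and §11.3] -/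
theorem isOfHodgeType_lineClass (p : Sys) (a b : ZMod 3) :
    IsOfHodgeType (2 * 1) X₃ (2 * 1) 1 1 (lineClass μ p a b) := by
  rw [lineClass_eq]
  obtain ⟨A⟩ := (nonempty_hodgeModel_holds (n := 1) (X := Motives.projectiveSpace 1 ℂ)).nonempty
    isSmoothProjective_P1
  exact isOfHodgeType_complexGysin hodgePQ_independent_of_hodgeModel_holds
    (fun m Y ↦ nonempty_hodgeModel_holds) (fun E _ _ _ ↦ exists_deRhamIsoFamily_holds E)
    μ isSmoothProjective_P1 isSmoothProjective_X₃ (lineEmb p a b) _ (p := 0) (q := 0)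
    (by norm_num) (by norm_num) (isOfHodgeType_zero_zero_zero A _)

/-! ### `ρ ≥ 7`: seven independent rational `(1,1)`-classes -/

/-- **`7 ≤ dim_ℂ span{c ∈ H²(X²₃(ℂ); ℂ) | c rational of Hodge type (1,1)}`** — the seven rescaled
line classes `uᵢ • cl(ℓᵢ)` are rational, of type `(1,1)` and linearly independent (in print: the
`27` lines span `NS(X²₃)`, of rank `7`, Hartshorne V Prop. 4.8 / Ex. 4.16; Aoki–Shioda (2.3)).
This is hypothesis `h₇` of `not_fermatHodgeClassesLiftToCurvePowers_of_finrank`.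
[cite: Hartshorne1977, V Prop. 4.8 and Ex. 4.16] [cite: AokiShioda1983, §2 (2.3)]
[cite: VoisinHodgeI2002, §11.3] -/
theorem seven_le_finrank_span_rational_one_one (μ : OrientationFamily) :
    7 ≤ Module.finrank ℂ (Submodule.span ℂ {c : complexBetti X₃ (2 * 1) |
      IsRationalClass c ∧ IsOfHodgeType (2 * 1) X₃ (2 * 1) 1 1 c}) := by
  choose u hu hrat using fun i : Fin 7 ↦
    exists_smul_lineClass_isRationalClass μ (sevenLines i).1 (sevenLines i).2.1 (sevenLines i).2.2
  set S := {c : complexBetti X₃ (2 * 1) | IsRationalClass c ∧ IsOfHodgeType (2 * 1) X₃ (2 * 1) 1 1 c}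
    with hS
  have hmem : ∀ i, u i • lineClass μ (sevenLines i).1 (sevenLines i).2.1 (sevenLines i).2.2 ∈
      Submodule.span ℂ S :=
    fun i ↦ Submodule.subset_span ⟨hrat i, (isOfHodgeType_lineClass μ _ _ _).smul _⟩
  have hli := linearIndependent_smul_sevenLineClasses μ u hu
  have hli' : LinearIndependent ℂ fun i : Fin 7 ↦
      (⟨_, hmem i⟩ : Submodule.span ℂ S) :=
    LinearIndependent.of_comp (Submodule.span ℂ S).subtype hli
  haveI : Module.Finite ℂ (complexBetti X₃ (2 * 1)) := finite_complexBetti isSmoothProjective_X₃ _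
  simpa using hli'.fintype_card_le_finrank

end Literature.AlgebraicGeometry.HodgeTheory

end
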